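import Summits.Ventures.PercRepro.MSTheoremS

/-!
# Lemma A⁺: a tight family with an up/down bipartition has at least two collisions

Let `G` be a tight family (`|G \\ G| = |G|`) and `F₁ ⊆ G` a nonempty, proper **up-set** of
`(G, ⊆)` (so `F₀ := G \ F₁` is a nonempty down-set). A pair `(t, s)` of members has *type I* if
`t ∈ F₁` and `s ∈ F₀`, *type II* otherwise; a **collision** is a difference `t \ s` realised by
pairs of both types (`(F₁ \\ (G \ F₁)) ∩ ((G \ F₁) \\ G ∪ G \\ F₁)`). The bipartition is *twin-free* if for no element `a` the
up-set `F₁` is exactly the set of members containing `a`.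

**Lemma A⁺** (`two_le_card_collisions`): a twin-free up/down bipartition of a tight family has at
least two collisions. Lemma A of Theorem S (`partner_nonempty_of_twinFree`, MSTwinLemmaA.lean) is
the statement that such a bipartition has at least one. Paper: proofs/MINE1-theoremS.md,
Addendum 18 — the proof runs in the product coordinates of Theorem S (`Rstar`, the addable part
`M`; every member is `x ∪ (M \ y)` with `x` outside `M` and `y ⊆ M`, and removing twin-closed sets
outside `M` or adding twin-closed sets inside `M` keeps a member a member), with the collision
generators (a) (a′) (b) (b′) (c) (c′) of the paper and a case analysis on a ⊆-minimal element of
`F₁` and a ⊆-maximal element of `F₀`.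

The statement is used for the excess-one theory of the V lane: at a nontrivial twin class `q`
of a family `F` that is not a difference, the trace `P_q` with the bipartition «members
containing `q`» / «members missing `q`» is twin-free and up/down, and the excess of `F` is the
excess of `P_q` plus the number of collisions — so if `P_q` is tight, `|D(F)| ≥ |F| + 2`.
-/

namespace PercRepro.MSTight

open Finset
open scoped FinsetFamily symmDiff

variable {α : Type*} [DecidableEq α] [Fintype α]

/-! The **collisions** of the bipartition `(F₁, G \ F₁)` of `G` — the differences realised by a
pair of type I (`t ∈ F₁`, `s ∉ F₁`) and by a pair of type II — form the set
`(F₁ \\ (G \ F₁)) ∩ ((G \ F₁) \\ G ∪ G \\ F₁)`, written out in every statement below (no new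
definition). -/

omit [Fintype α] in
/-- A collision from an explicit pair of realisations. -/
theorem mem_collisions_of {G F₁ : Finset (Finset α)} {t₁ s₁ t₂ s₂ : Finset α}
    (ht₁ : t₁ ∈ F₁) (hs₁G : s₁ ∈ G) (hs₁ : s₁ ∉ F₁) (ht₂ : t₂ ∈ G) (hs₂ : s₂ ∈ G)
    (h2 : t₂ ∉ F₁ ∨ s₂ ∈ F₁) (he : t₂ \ s₂ = t₁ \ s₁) : t₁ \ s₁ ∈ (F₁ \\ (G \ F₁)) ∩ ((G \ F₁) \\ G ∪ G \\ F₁) := by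
  refine mem_inter.2 ⟨mem_diffs.2 ⟨t₁, ht₁, s₁, mem_sdiff.2 ⟨hs₁G, hs₁⟩, rfl⟩, ?_⟩
  rcases h2 with h2 | h2
  · exact mem_union.2 (Or.inl (mem_diffs.2 ⟨t₂, mem_sdiff.2 ⟨ht₂, h2⟩, s₂, hs₂, he⟩))
  · exact mem_union.2 (Or.inr (mem_diffs.2 ⟨t₂, ht₂, s₂, h2, he⟩))

section Tight

variable {G F₁ : Finset (Finset α)}

/-- Removing a twin-closed set disjoint from the addable part keeps a member of a tight family
a member. -/
theorem sdiff_mem_of_tight_of_disjoint_Rstar (hG : Tight G) {Z : Finset α}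
    (hZ : TwinClosed G Z) (hZM : Disjoint Z (Rstar G)) {t : Finset α} (ht : t ∈ G) :
    t \ Z ∈ G :=
  sdiff_mem_of_closedRem hZ
    (fun _ ha => closedRem_of_notMem_Rstar (dichotomy_of_tight hG)
      (Finset.disjoint_left.1 hZM ha)) ht

/-- Adding a twin-closed subset of the addable part keeps a member a member. -/
theorem union_mem_of_subset_Rstar {Z : Finset α}
    (hZ : TwinClosed G Z) (hZM : Z ⊆ Rstar G) {t : Finset α} (ht : t ∈ G) : t ∪ Z ∈ G :=
  union_mem_of_closedAdd hZ (fun _ ha => mem_Rstar.1 (hZM ha)) ht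

omit [Fintype α] in
/-- `(m \ z) \ (s \ z) = m \ s` when `z ⊆ s`. -/
theorem sdiff_sdiff_sdiff_eq_of_subset {m s z : Finset α} (hz : z ⊆ s) :
    (m \ z) \ (s \ z) = m \ s := by
  ext x
  simp only [mem_sdiff, not_and, not_not]
  constructor
  · rintro ⟨⟨hm, hz'⟩, h⟩
    exact ⟨hm, fun hs => hz' (h hs)⟩
  · rintro ⟨hm, hs⟩
    exact ⟨⟨hm, fun hz' => hs (hz hz')⟩, fun hs' => absurd hs' hs⟩

omit [Fintype α] in
/-- `(t ∪ w) \ (s ∪ w) = t \ s` when `w` is disjoint from `t`. -/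
theorem union_sdiff_union_eq_of_disjoint {t s w : Finset α} (hw : Disjoint w t) :
    (t ∪ w) \ (s ∪ w) = t \ s := by
  ext x
  simp only [mem_sdiff, mem_union, not_or]
  constructor
  · rintro ⟨ht | hw', hs, hw''⟩
    · exact ⟨ht, hs⟩
    · exact absurd hw' hw''
  · rintro ⟨ht, hs⟩
    exact ⟨Or.inl ht, hs, Finset.disjoint_right.1 hw ht⟩

/-- **Generator (a).** Let `m` be a ⊆-minimal member of `F₁` and `s ∈ F₀` a member whose part
outside the addable part meets that of `m`. Then `m \ s` is a collision. -/
theorem collision_of_minimal_of_inter_sdiff_Rstar_nonempty (hG : Tight G) (hsub : F₁ ⊆ G)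
    {m : Finset α} (hm : m ∈ F₁) (hmin : ∀ t ∈ F₁, t ⊆ m → t = m)
    {s : Finset α} (hsG : s ∈ G) (hs : s ∉ F₁) (hne : ((m ∩ s) \ Rstar G).Nonempty) :
    m \ s ∈ (F₁ \\ (G \ F₁)) ∩ ((G \ F₁) \\ G ∪ G \\ F₁) := by
  set z := (m ∩ s) \ Rstar G with hz
  have hzt : TwinClosed G z :=
    ((twinClosed_of_mem (hsub hm)).inter (twinClosed_of_mem hsG)).sdiff (twinClosed_Rstar G)
  have hzM : Disjoint z (Rstar G) := Finset.disjoint_left.2 fun x hx => (mem_sdiff.1 hx).2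
  have hzm : z ⊆ m := fun x hx => (mem_inter.1 (mem_sdiff.1 hx).1).1
  have hzs : z ⊆ s := fun x hx => (mem_inter.1 (mem_sdiff.1 hx).1).2
  have hm' : m \ z ∈ G := sdiff_mem_of_tight_of_disjoint_Rstar hG hzt hzM (hsub hm)
  have hs' : s \ z ∈ G := sdiff_mem_of_tight_of_disjoint_Rstar hG hzt hzM hsG
  -- `m \ z` is a proper subset of `m`, hence not in `F₁`
  have hm'F : m \ z ∉ F₁ := by
    intro h
    have := hmin _ h sdiff_subset
    have hzempty : z = ∅ := by
      rw [Finset.eq_empty_iff_forall_notMem]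
      intro x hx
      have hxm : x ∈ m \ z := by
        rw [this]
        exact hzm hx
      exact (mem_sdiff.1 hxm).2 hx
    exact hne.ne_empty hzempty
  exact mem_collisions_of hm hsG hs hm' hs' (Or.inl hm'F)
    (sdiff_sdiff_sdiff_eq_of_subset hzs)

/-- **Generator (a′).** Let `s` be a ⊆-maximal member of `F₀` and `t ∈ F₁` a member such that
`s` and `t` both miss a common part of the addable part. Then `t \ s` is a collision. -/
theorem collision_of_maximal_of_Rstar_sdiff_union_nonempty (hsub : F₁ ⊆ G)
    (hup : ∀ t ∈ F₁, ∀ s ∈ G, t ⊆ s → s ∈ F₁)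
    {s : Finset α} (hsG : s ∈ G) (hs : s ∉ F₁) (hmax : ∀ t ∈ G, t ∉ F₁ → s ⊆ t → t = s)
    {t : Finset α} (ht : t ∈ F₁) (hne : (Rstar G \ (s ∪ t)).Nonempty) :
    t \ s ∈ (F₁ \\ (G \ F₁)) ∩ ((G \ F₁) \\ G ∪ G \\ F₁) := by
  set w := Rstar G \ (s ∪ t) with hw
  have hwt : TwinClosed G w :=
    (twinClosed_Rstar G).sdiff ((twinClosed_of_mem hsG).union (twinClosed_of_mem (hsub ht)))
  have hwM : w ⊆ Rstar G := fun x hx => (mem_sdiff.1 hx).1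
  have hws : Disjoint w s := Finset.disjoint_left.2 fun x hx hxs =>
    (mem_sdiff.1 hx).2 (mem_union.2 (Or.inl hxs))
  have hwt' : Disjoint w t := Finset.disjoint_left.2 fun x hx hxt =>
    (mem_sdiff.1 hx).2 (mem_union.2 (Or.inr hxt))
  have hs' : s ∪ w ∈ G := union_mem_of_subset_Rstar hwt hwM hsG
  have ht' : t ∪ w ∈ G := union_mem_of_subset_Rstar hwt hwM (hsub ht)
  -- `s ∪ w` is a proper superset of `s`, hence in `F₁`
  have hs'F : s ∪ w ∈ F₁ := by
    by_contra h
    have := hmax _ hs' h subset_union_left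
    have hwempty : w = ∅ := by
      rw [Finset.eq_empty_iff_forall_notMem]
      intro x hx
      have hxs : x ∈ s := by
        rw [← this]
        exact mem_union.2 (Or.inr hx)
      exact Finset.disjoint_left.1 hws hx hxs
    exact hne.ne_empty hwempty
  have ht'F : t ∪ w ∈ F₁ := hup t ht _ ht' subset_union_left
  exact mem_collisions_of ht hsG hs ht' hs' (Or.inr hs'F) (union_sdiff_union_eq_of_disjoint hwt')

omit [Fintype α] in
/-- A collision is a nonempty set (a type-I pair with empty difference would put a member of
`F₀` above a member of `F₁`). -/
theorem nonempty_of_mem_collisions (hup : ∀ t ∈ F₁, ∀ s ∈ G, t ⊆ s → s ∈ F₁) {E : Finset α}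
    (hE : E ∈ (F₁ \\ (G \ F₁)) ∩ ((G \ F₁) \\ G ∪ G \\ F₁)) : E.Nonempty := by
  obtain ⟨t, ht, s, hs, rfl⟩ := mem_diffs.1 (mem_inter.1 hE).1
  rw [Finset.nonempty_iff_ne_empty]
  intro h
  rw [sdiff_eq_empty_iff_subset] at h
  exact (mem_sdiff.1 hs).2 (hup t ht s (mem_sdiff.1 hs).1 h)

/-- **Generator (b).** A nonempty twin-closed proper part `z` of the non-addable part of a
⊆-minimal member `m` of `F₁` is a collision. -/
theorem collision_of_minimal_of_ssubset (hG : Tight G) (hsub : F₁ ⊆ G)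
    {m : Finset α} (hm : m ∈ F₁) (hmin : ∀ t ∈ F₁, t ⊆ m → t = m)
    {z : Finset α} (hzt : TwinClosed G z) (hzm : z ⊆ m \ Rstar G) (hzne : z.Nonempty)
    (hzp : z ≠ m \ Rstar G) : z ∈ (F₁ \\ (G \ F₁)) ∩ ((G \ F₁) \\ G ∪ G \\ F₁) := by
  have hzM : Disjoint z (Rstar G) := Finset.disjoint_left.2 fun x hx => (mem_sdiff.1 (hzm hx)).2
  have hzm' : z ⊆ m := fun x hx => (mem_sdiff.1 (hzm hx)).1
  have hs' : m \ z ∈ G := sdiff_mem_of_tight_of_disjoint_Rstar hG hzt hzM (hsub hm)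
  have hs'F : m \ z ∉ F₁ := by
    intro h
    have := hmin _ h sdiff_subset
    refine hzne.ne_empty ?_
    rw [Finset.eq_empty_iff_forall_notMem]
    intro x hx
    have hxm : x ∈ m \ z := by
      rw [this]
      exact hzm' hx
    exact (mem_sdiff.1 hxm).2 hx
  have hne : ((m ∩ (m \ z)) \ Rstar G).Nonempty := by
    have hxne : ((m \ Rstar G) \ z).Nonempty := by
      rw [Finset.nonempty_iff_ne_empty]
      intro h
      rw [sdiff_eq_empty_iff_subset] at h
      exact hzp (subset_antisymm hzm h)
    obtain ⟨x, hx⟩ := hxne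
    refine ⟨x, ?_⟩
    simp only [mem_sdiff, mem_inter] at hx ⊢
    exact ⟨⟨hx.1.1, hx.1.1, hx.2⟩, hx.1.2⟩
  have h := collision_of_minimal_of_inter_sdiff_Rstar_nonempty hG hsub hm hmin hs' hs'F hne
  rwa [Finset.sdiff_sdiff_eq_self hzm'] at h

/-- **Generator (b′).** A nonempty twin-closed proper part `w` of the missing addable part of a
⊆-maximal member `s` of `F₀` is a collision. -/
theorem collision_of_maximal_of_ssubset (hsub : F₁ ⊆ G)
    (hup : ∀ t ∈ F₁, ∀ s ∈ G, t ⊆ s → s ∈ F₁)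
    {s : Finset α} (hsG : s ∈ G) (hs : s ∉ F₁) (hmax : ∀ t ∈ G, t ∉ F₁ → s ⊆ t → t = s)
    {w : Finset α} (hwt : TwinClosed G w) (hws : w ⊆ Rstar G \ s) (hwne : w.Nonempty)
    (hwp : w ≠ Rstar G \ s) : w ∈ (F₁ \\ (G \ F₁)) ∩ ((G \ F₁) \\ G ∪ G \\ F₁) := by
  have hwM : w ⊆ Rstar G := fun x hx => (mem_sdiff.1 (hws hx)).1
  have hws' : Disjoint w s := Finset.disjoint_left.2 fun x hx hxs => (mem_sdiff.1 (hws hx)).2 hxs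
  have ht' : s ∪ w ∈ G := union_mem_of_subset_Rstar hwt hwM hsG
  have ht'F : s ∪ w ∈ F₁ := by
    by_contra h
    have := hmax _ ht' h subset_union_left
    refine hwne.ne_empty ?_
    rw [Finset.eq_empty_iff_forall_notMem]
    intro x hx
    have hxs : x ∈ s := by
      rw [← this]
      exact mem_union.2 (Or.inr hx)
    exact Finset.disjoint_left.1 hws' hx hxs
  have hne : (Rstar G \ (s ∪ (s ∪ w))).Nonempty := by
    have hxne : ((Rstar G \ s) \ w).Nonempty := by
      rw [Finset.nonempty_iff_ne_empty]
      intro h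
      rw [sdiff_eq_empty_iff_subset] at h
      exact hwp (subset_antisymm hws h)
    obtain ⟨x, hx⟩ := hxne
    refine ⟨x, ?_⟩
    simp only [mem_sdiff, mem_union, not_or] at hx ⊢
    exact ⟨hx.1.1, hx.1.2, hx.1.2, hx.2⟩
  have h := collision_of_maximal_of_Rstar_sdiff_union_nonempty hsub hup hsG hs hmax ht'F hne
  have e : (s ∪ w) \ s = w := by
    ext x
    simp only [mem_sdiff, mem_union]
    constructor
    · rintro ⟨hx | hx, hxs⟩
      · exact absurd hx hxs
      · exact hx
    · intro hx
      exact ⟨Or.inr hx, Finset.disjoint_left.1 hws' hx⟩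
  rwa [e] at h

/-- **Generator (c).** Let `m` be a ⊆-minimal member of `F₁` whose non-addable part is the
single twin class of `a`, and `t ∈ F₁` a member avoiding `a`. Then `t \ m` is a collision. -/
theorem collision_of_minimal_cls (hG : Tight G) (hsub : F₁ ⊆ G)
    {m : Finset α} (hm : m ∈ F₁) (hmin : ∀ t ∈ F₁, t ⊆ m → t = m) {a : α}
    (hma : m \ Rstar G = cls G a) {t : Finset α} (ht : t ∈ F₁) (hat : a ∉ t) :
    t \ m ∈ (F₁ \\ (G \ F₁)) ∩ ((G \ F₁) \\ G ∪ G \\ F₁) := by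
  have haM : a ∉ Rstar G := by
    have : a ∈ m \ Rstar G := hma ▸ self_mem_cls G a
    exact (mem_sdiff.1 this).2
  have hclsM : Disjoint (cls G a) (Rstar G) :=
    disjoint_cls_of_twinClosed_of_notMem (twinClosed_Rstar G) haM
  have hclsm : cls G a ⊆ m := fun x hx => (mem_sdiff.1 (hma ▸ hx)).1
  have hs' : m \ cls G a ∈ G :=
    sdiff_mem_of_tight_of_disjoint_Rstar hG (twinClosed_cls G a) hclsM (hsub hm)
  have hs'F : m \ cls G a ∉ F₁ := by
    intro h
    have := hmin _ h sdiff_subset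
    have hxm : a ∈ m \ cls G a := by
      rw [this]
      exact hclsm (self_mem_cls G a)
    exact (mem_sdiff.1 hxm).2 (self_mem_cls G a)
  have hdis : Disjoint (cls G a) t := disjoint_cls_of_notMem (hsub ht) hat
  have e : t \ m = t \ (m \ cls G a) := by
    ext x
    simp only [mem_sdiff, not_and, not_not]
    constructor
    · rintro ⟨hxt, hxm⟩
      exact ⟨hxt, fun h => absurd h hxm⟩
    · rintro ⟨hxt, h⟩
      refine ⟨hxt, fun hxm => Finset.disjoint_left.1 hdis (h hxm) hxt⟩
  rw [e]
  exact mem_collisions_of ht hs' hs'F (hsub ht) (hsub hm) (Or.inr hm) e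

/-- **Generator (c′).** Let `s` be a ⊆-maximal member of `F₀` whose missing addable part is the
single twin class of `b`, and `s' ∈ F₀` a member containing `b`. Then `(s ∪ cls G b) \ s'` is a
collision. -/
theorem collision_of_maximal_cls
    {s : Finset α} (hsG : s ∈ G) (hs : s ∉ F₁) (hmax : ∀ t ∈ G, t ∉ F₁ → s ⊆ t → t = s)
    {b : α} (hsb : Rstar G \ s = cls G b) {s' : Finset α} (hs'G : s' ∈ G) (hs' : s' ∉ F₁)
    (hbs' : b ∈ s') : (s ∪ cls G b) \ s' ∈ (F₁ \\ (G \ F₁)) ∩ ((G \ F₁) \\ G ∪ G \\ F₁) := by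
  have hbs : b ∉ s := by
    have : b ∈ Rstar G \ s := hsb ▸ self_mem_cls G b
    exact (mem_sdiff.1 this).2
  have hclsM : cls G b ⊆ Rstar G := fun x hx => (mem_sdiff.1 (hsb ▸ hx)).1
  have ht' : s ∪ cls G b ∈ G := union_mem_of_subset_Rstar (twinClosed_cls G b) hclsM hsG
  have ht'F : s ∪ cls G b ∈ F₁ := by
    by_contra h
    have := hmax _ ht' h subset_union_left
    have hxs : b ∈ s := by
      rw [← this]
      exact mem_union.2 (Or.inr (self_mem_cls G b))
    exact hbs hxs
  have hcls : cls G b ⊆ s' := cls_subset_of_mem hs'G hbs'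
  have e : s \ s' = (s ∪ cls G b) \ s' := by
    ext x
    simp only [mem_sdiff, mem_union]
    constructor
    · rintro ⟨hxs, hxs'⟩
      exact ⟨Or.inl hxs, hxs'⟩
    · rintro ⟨hxs | hxb, hxs'⟩
      · exact ⟨hxs, hxs'⟩
      · exact absurd (hcls hxb) hxs'
  exact mem_collisions_of ht'F hs'G hs' hsG hs'G (Or.inl hs) e

omit [DecidableEq α] [Fintype α] in
/-- A ⊆-minimal member of `F₁`. -/
theorem exists_minimal_subset (hne : F₁.Nonempty) :
    ∃ m ∈ F₁, ∀ t ∈ F₁, t ⊆ m → t = m := by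
  obtain ⟨m, hm, hmin⟩ := exists_min_image F₁ Finset.card hne
  refine ⟨m, hm, fun t ht hts => ?_⟩
  exact Finset.eq_of_subset_of_card_le hts (hmin t ht)

omit [Fintype α] in
/-- A ⊆-minimal member of `F₁` below a given member of `F₁`. -/
theorem exists_minimal_subset_of_mem {t : Finset α} (ht : t ∈ F₁) :
    ∃ m ∈ F₁, m ⊆ t ∧ ∀ t' ∈ F₁, t' ⊆ m → t' = m := by
  obtain ⟨m, hm, hmin⟩ := exists_min_image (F₁.filter (· ⊆ t)) Finset.card
    ⟨t, mem_filter.2 ⟨ht, subset_rfl⟩⟩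
  obtain ⟨hmF, hmt⟩ := mem_filter.1 hm
  refine ⟨m, hmF, hmt, fun t' ht' hts => ?_⟩
  exact Finset.eq_of_subset_of_card_le hts (hmin t' (mem_filter.2 ⟨ht', hts.trans hmt⟩))

omit [Fintype α] in
/-- A ⊆-maximal member of `F₀ = G \ F₁` above a given member of `F₀`. -/
theorem exists_maximal_superset_of_mem {t : Finset α} (htG : t ∈ G) (ht : t ∉ F₁) :
    ∃ s ∈ G, s ∉ F₁ ∧ t ⊆ s ∧ ∀ t' ∈ G, t' ∉ F₁ → s ⊆ t' → t' = s := by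
  obtain ⟨s, hs, hmax⟩ := exists_max_image ((G \ F₁).filter (t ⊆ ·)) Finset.card
    ⟨t, mem_filter.2 ⟨mem_sdiff.2 ⟨htG, ht⟩, subset_rfl⟩⟩
  obtain ⟨hsGF, hts⟩ := mem_filter.1 hs
  obtain ⟨hsG, hsF⟩ := mem_sdiff.1 hsGF
  refine ⟨s, hsG, hsF, hts, fun t' ht'G ht'F hst' => ?_⟩
  exact (Finset.eq_of_subset_of_card_le hst'
    (hmax t' (mem_filter.2 ⟨mem_sdiff.2 ⟨ht'G, ht'F⟩, hts.trans hst'⟩))).symm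

end Tight

end PercRepro.MSTight
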